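import Summits.KontsevichZagierPeriods.KontsevichZagierPeriods.Theorems.RootDecompWalshStrataConeChart
import Summits.KontsevichZagierPeriods.KontsevichZagierPeriods.Theorems.RootDecompWalshStrataConeBaker

/-!
# The split specimen `xy + zw > 1`, part 1/3: Newton–Leibniz along `x₃`

Route `RootDecompWalshStrata` (cell decomp-kz, lens 4, gen 11), support toward `QuadricSignKernel`
(item stmt-KontsevichZagierPeriods-25393), slice `d = 4`: the quadric 4-cell
`(0,1)⁴ ∩ {x₀x₁ + x₂x₃ > 1}` — the SPLIT affine type (quadratic part of signature `(2,2)`; value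
`q(π²/12 − 3/4)`).  The cell is the open band `(1 − x₀x₁)/x₂ < x₃ < 1` over the Walsh 3-cell
`B₁ = (0,1)³ ∩ {u₂ + u₀u₁ > 1}`; rule (3) along `x₃` with the primitive `q·x₃` and rule (1a) give
`[cell, q] − [B₁, q(u₂ + u₀u₁ − 1)/u₂] ∈ KZ.relations` — a RATIONAL weight, BOUNDED by `|q|` but not
continuous on the closed cube, whence the small integrability-by-boundedness helper
`integrableOn_of_bdd`.  No square roots anywhere in this specimen.  0 sorry.
[KontsevichZagier2001 §1.2 rules (1), (3)]
-/

noncomputable section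

open Literature.NumberTheory.Transcendental
open MeasureTheory Set
open MvPolynomial (aeval X C)
open Literature.ModelTheory.ExponentialFields (IsSemialgebraic isSemialgebraic_setOf_eval_pos
  isSemialgebraic_setOf_eval_lt continuous_aeval_real)
open Summit.KontsevichZagierPeriods.RootDecompWalshStrata.WalshSpanProof (isSemialgebraic_cubeSet
  isBounded_cubeSet cellRep cellRep_domain cellRep_integrand)
open Summit.KontsevichZagierPeriods.RootDecompWalshStrata.ConeSpecimen (cubeCell_subset_Icc)

namespace Summit.KontsevichZagierPeriods.RootDecompWalshStrata.Split4

/-! #### Integrability of bounded weights -/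

/-- A measurable function bounded on a measurable subset of the unit cube is integrable there.
[folklore] -/
theorem integrableOn_of_bdd {n : ℕ} {f : (Fin n → ℝ) → ℝ} {s : Set (Fin n → ℝ)} (hs : s ⊆ Icc 0 1)
    (hsm : MeasurableSet s) (hf : Measurable f) (M : ℝ) (hb : ∀ x ∈ s, |f x| ≤ M) :
    IntegrableOn f s :=
  Measure.integrableOn_of_bounded ((measure_mono hs).trans_lt isCompact_Icc.measure_lt_top).ne
    hf.aestronglyMeasurable (ae_restrict_of_forall_mem hsm fun x hx => by
      simpa only [Real.norm_eq_abs] using hb x hx)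

/-! #### The cell and the base `B₁` -/

/-- The split quadric `x₀x₁ + x₂x₃ − 1`. -/
def split4Poly : MvPolynomial (Fin 4) ℚ := X 0 * X 1 + X 2 * X 3 - 1

/-- Evaluation of the split quadric. [definition] -/
@[simp] theorem aeval_split4Poly (x : Fin 4 → ℝ) :
    aeval x split4Poly = x 0 * x 1 + x 2 * x 3 - 1 := by
  simp [split4Poly]

/-- The base quadric `u₂ + u₀u₁ − 1`. -/
def base3Poly : MvPolynomial (Fin 3) ℚ := X 2 + X 0 * X 1 - 1

/-- Evaluation of the base quadric. [definition] -/
@[simp] theorem aeval_base3Poly (u : Fin 3 → ℝ) : aeval u base3Poly = u 2 + u 0 * u 1 - 1 := by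
  simp [base3Poly]

/-- The base `B₁ = (0,1)³ ∩ {u₂ + u₀u₁ > 1}` (a Walsh 3-cell). -/
def b1Set : Set (Fin 3 → ℝ) := {u | (∀ j, 0 < u j ∧ u j < 1) ∧ 0 < aeval u base3Poly}

/-- `B₁` is `ℚ`-semialgebraic. [BCR1998 §2.1] -/
theorem isSemialgebraic_b1Set : IsSemialgebraic ℚ b1Set := (cellRep base3Poly 0).isSemialgebraic_domain

/-- `B₁ ⊆ [0,1]³`. [folklore] -/
theorem b1Set_subset_Icc : b1Set ⊆ Icc 0 1 := cubeCell_subset_Icc base3Poly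

/-- Membership in `B₁`, in coordinates. [definition] -/
theorem mem_b1Set {u : Fin 3 → ℝ} :
    u ∈ b1Set ↔ ((0 < u 0 ∧ u 0 < 1) ∧ (0 < u 1 ∧ u 1 < 1) ∧ (0 < u 2 ∧ u 2 < 1)) ∧
      0 < u 2 + u 0 * u 1 - 1 := by
  simp only [b1Set, mem_setOf_eq, aeval_base3Poly]
  exact ⟨fun ⟨hu, hc⟩ => ⟨⟨hu 0, hu 1, hu 2⟩, hc⟩, fun ⟨⟨h0, h1, h2⟩, hc⟩ =>
    ⟨fun j => by fin_cases j <;> assumption, hc⟩⟩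

/-- On `B₁` the descended weight is between `0` and `q`: `0 < (u₂ + u₀u₁ − 1)/u₂ < 1`. [folklore] -/
theorem ratio_mem_Ioo {u : Fin 3 → ℝ} (hu : u ∈ b1Set) :
    0 < (u 2 + u 0 * u 1 - 1) / u 2 ∧ (u 2 + u 0 * u 1 - 1) / u 2 < 1 := by
  rw [mem_b1Set] at hu
  obtain ⟨⟨h0, h1, h2⟩, hc⟩ := hu
  refine ⟨div_pos hc h2.1, (div_lt_one h2.1).2 ?_⟩
  nlinarith [mul_lt_mul'' h0.2 h1.2 h0.1.le h1.1.le]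

/-- `[B₁, q(u₂ + u₀u₁ − 1)/u₂]`: the representation after the first descent (a bounded rational
weight on a Walsh 3-cell). [KontsevichZagier2001 §1.1] -/
def b1WRep (q : ℚ) : KZ.IntegralRep 3 where
  domain := b1Set
  integrand u := (q : ℝ) * (u 2 + u 0 * u 1 - 1) / u 2
  isSemialgebraic_domain := isSemialgebraic_b1Set
  isSemialgebraicFunOn_integrand :=
    (isSemialgebraicFunOn_aeval_div_aeval isSemialgebraic_b1Set (C q * (X 2 + X 0 * X 1 - 1)) (X 2)
      fun u hu => by simpa using ((mem_b1Set.1 hu).1.2.2.1).ne').congr fun u _ => by simp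
  integrableOn := by
    refine integrableOn_of_bdd b1Set_subset_Icc isSemialgebraic_b1Set.measurableSet_holds
      (by fun_prop) |(q : ℝ)| fun u hu => ?_
    have h := ratio_mem_Ioo hu
    rw [mul_div_assoc, abs_mul, abs_of_pos h.1]
    exact mul_le_of_le_one_right (abs_nonneg _) h.2.le

/-- The domain of the descended representation. [definition] -/
@[simp] theorem b1WRep_domain (q : ℚ) : (b1WRep q).domain = b1Set := rfl

/-- The integrand of the descended representation. [definition] -/
@[simp] theorem b1WRep_integrand (q : ℚ) (u : Fin 3 → ℝ) :
    (b1WRep q).integrand u = (q : ℝ) * (u 2 + u 0 * u 1 - 1) / u 2 := rfl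

/-! #### The cell is the open band `(1 − u₀u₁)/u₂ < x₃ < 1` over `B₁` -/

/-- The lower edge `a(u) = (1 − u₀u₁)/u₂` of the band. -/
def aEdge (u : Fin 3 → ℝ) : ℝ := (1 - u 0 * u 1) / u 2

/-- The lower edge is `ℚ`-semialgebraic on `B₁` (a rational function with non-vanishing
denominator). [BCR1998 §2.2] -/
theorem isSemialgebraicFunOn_aEdge : IsSemialgebraicFunOn ℚ b1Set aEdge :=
  (isSemialgebraicFunOn_aeval_div_aeval isSemialgebraic_b1Set (1 - X 0 * X 1 : MvPolynomial (Fin 3) ℚ)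
    (X 2) fun u hu => by simpa using ((mem_b1Set.1 hu).1.2.2.1).ne').congr fun u _ => by
    simp [aEdge]

/-- On `B₁`, `0 < a(u) ≤ 1`. [folklore] -/
theorem aEdge_pos_le {u : Fin 3 → ℝ} (hu : u ∈ b1Set) : 0 < aEdge u ∧ aEdge u ≤ 1 := by
  rw [mem_b1Set] at hu
  obtain ⟨⟨h0, h1, h2⟩, hc⟩ := hu
  refine ⟨div_pos (by nlinarith [mul_lt_mul'' h0.2 h1.2 h0.1.le h1.1.le]) h2.1,
    (div_le_one h2.1).2 (by linarith)⟩

/-- Coordinates of `Fin.snoc` on `ℝ³ × ℝ`. [definition] -/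
@[simp] private theorem snoc₃_apply (u : Fin 3 → ℝ) (s : ℝ) :
    (Fin.snoc u s : Fin 4 → ℝ) 3 = s ∧ (Fin.snoc u s : Fin 4 → ℝ) 0 = u 0 ∧
      (Fin.snoc u s : Fin 4 → ℝ) 1 = u 1 ∧ (Fin.snoc u s : Fin 4 → ℝ) 2 = u 2 := ⟨rfl, rfl, rfl, rfl⟩

/-- Membership in the split cell in band form: the cell is the open band `a(u) < x₃ < 1` over `B₁`.
[folklore] -/
theorem mem_cell_iff_init (q : ℚ) (x : Fin 4 → ℝ) :
    x ∈ (cellRep split4Poly q).domain ↔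
      Fin.init x ∈ b1Set ∧ aEdge (Fin.init x) < x (Fin.last 3) ∧ x (Fin.last 3) < 1 := by
  rw [cellRep_domain]
  have hb1 : Fin.init x ∈ b1Set ↔
      ((0 < x 0 ∧ x 0 < 1) ∧ (0 < x 1 ∧ x 1 < 1) ∧ (0 < x 2 ∧ x 2 < 1)) ∧
        0 < x 2 + x 0 * x 1 - 1 := by
    rw [mem_b1Set]
    rfl
  have hcube : (∀ j : Fin 4, 0 < x j ∧ x j < 1) ↔
      (0 < x 0 ∧ x 0 < 1) ∧ (0 < x 1 ∧ x 1 < 1) ∧ (0 < x 2 ∧ x 2 < 1) ∧ (0 < x 3 ∧ x 3 < 1) :=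
    ⟨fun h => ⟨h 0, h 1, h 2, h 3⟩, fun ⟨h0, h1, h2, h3⟩ j => by fin_cases j <;> assumption⟩
  have ha : aEdge (Fin.init x) = (1 - x 0 * x 1) / x 2 := rfl
  have hl : x (Fin.last 3) = x 3 := rfl
  simp only [mem_setOf_eq, aeval_split4Poly]
  rw [hcube, hb1, ha, hl]
  constructor
  · rintro ⟨⟨h0, h1, h2, h3⟩, hP⟩
    refine ⟨⟨⟨h0, h1, h2⟩, by nlinarith [mul_lt_mul_of_pos_left h3.2 h2.1]⟩,
      (div_lt_iff₀ h2.1).2 (by linarith), h3.2⟩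
  · rintro ⟨⟨⟨h0, h1, h2⟩, _⟩, hlo, h3⟩
    have hlo' : 1 - x 0 * x 1 < x 3 * x 2 := (div_lt_iff₀ h2.1).1 hlo
    have h01 : x 0 * x 1 < 1 := by nlinarith [mul_lt_mul'' h0.2 h1.2 h0.1.le h1.1.le]
    have hx3 : 0 < x 3 := by nlinarith [h2.2]
    exact ⟨⟨h0, h1, h2, hx3, h3⟩, by linarith⟩

/-- The closed band `a(u) ≤ x₃ ≤ 1` over `B₁` lies in `[0,1]⁴`. [folklore] -/
theorem band_b1Set_subset_Icc : KZlog.band b1Set aEdge (fun _ => (1:ℝ)) ⊆ Icc 0 1 := by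
  intro x hx
  rw [KZlog.mem_band] at hx
  obtain ⟨hu, h0, h1⟩ := hx
  have hlo : 0 ≤ aEdge (Fin.init x) := (aEdge_pos_le hu).1.le
  have hu' := (mem_b1Set.1 hu).1
  obtain ⟨hu0, hu1, hu2⟩ := hu'
  refine ⟨fun j => ?_, fun j => ?_⟩
  · fin_cases j
    · exact hu0.1.le
    · exact hu1.1.le
    · exact hu2.1.le
    · exact hlo.trans h0
  · fin_cases j
    · exact hu0.2.le
    · exact hu1.2.le
    · exact hu2.2.le
    · exact h1

/-! #### Moves (3) + (1a): `[cell, q] ≡ [B₁, q(u₂ + u₀u₁ − 1)/u₂]` -/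

/-- **Moves (3) + (1a):** Newton–Leibniz along `x₃` with the primitive `q·x₃` over `B₁` (closed
fibres `[(1 − u₀u₁)/u₂, 1]`), then opening the fibres:
`[(0,1)⁴ ∩ {x₀x₁ + x₂x₃ > 1}, q] − [B₁, q(u₂ + u₀u₁ − 1)/u₂] ∈ KZ.relations` (`4 → 3`).
[KontsevichZagier2001 §1.2 rules (1), (3); this node] -/
theorem of_cell_sub_of_b1WRep_mem_relations (q : ℚ) :
    KZ.of (cellRep split4Poly q) - KZ.of (b1WRep q) ∈ KZ.relations := by
  have hBs := isSemialgebraic_b1Set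
  have ha : IsSemialgebraicFunOn ℚ b1Set aEdge := isSemialgebraicFunOn_aEdge
  have hb : IsSemialgebraicFunOn ℚ b1Set (fun _ => (1:ℝ)) := by
    simpa using isSemialgebraicFunOn_ratCast hBs 1
  have hab : ∀ u ∈ b1Set, aEdge u ≤ (fun _ => (1:ℝ)) u := fun u hu => (aEdge_pos_le hu).2
  have hband : IsSemialgebraic ℚ (KZlog.band b1Set aEdge (fun _ => (1:ℝ))) :=
    KZlog.isSemialgebraic_band ha hb
  have hbdry : ∀ u ∈ b1Set,
      (q : ℝ) * (Fin.snoc u ((fun _ => (1:ℝ)) u) : Fin 4 → ℝ) 3 -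
        (q : ℝ) * (Fin.snoc u (aEdge u) : Fin 4 → ℝ) 3 = (b1WRep q).integrand u := by
    intro u hu
    have h2 : u 2 ≠ 0 := ((mem_b1Set.1 hu).1.2.2.1).ne'
    simp only [snoc₃_apply, b1WRep_integrand, aEdge]
    field_simp
    ring
  obtain ⟨rb, rd, hrbd, hrbi, hrdd, hrdi, hrel⟩ := KZ.exists_band_newtonLeibniz hBs
    aEdge (fun _ => (1:ℝ)) ha hb hab
    (fun x => (q : ℝ) * x 3) (fun _ => (q : ℝ))
    ((isSemialgebraicFunOn_aeval hband (C q * X 3)).congr fun x _ => by simp)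
    (by simpa using isSemialgebraicFunOn_ratCast hband q)
    (fun u _ => by
      simp only [snoc₃_apply]
      exact (continuous_const.mul continuous_id).continuousOn)
    (fun u _ s _ => by
      simp only [snoc₃_apply]
      exact ((hasDerivAt_id s).const_mul (q : ℝ)).congr_deriv (mul_one _))
    ((continuous_const.continuousOn.integrableOn_compact isCompact_Icc).mono_set
      band_b1Set_subset_Icc)
    ((b1WRep q).isSemialgebraicFunOn_integrand.congr fun u hu => (hbdry u hu).symm)
    (((b1WRep q).integrableOn.congr_fun (fun u hu => (hbdry u hu).symm)
      isSemialgebraic_b1Set.measurableSet_holds))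
  obtain ⟨rb', hrb'd, hrb'i, hrel'⟩ := KZ.of_sub_of_restrict_openBand_mem_relations ha hb rb hrbd
  have hpin1 : KZ.of rb' - KZ.of (cellRep split4Poly q) ∈ KZ.relations := by
    refine KZ.of_sub_of_mem_relations_of_eqOn ?_ fun x _ => ?_
    · rw [hrb'd]
      ext x
      exact mem_cell_iff_init q x
    · rw [hrb'i, hrbi, cellRep_integrand]
  have hpin2 : KZ.of rd - KZ.of (b1WRep q) ∈ KZ.relations := by
    refine KZ.of_sub_of_mem_relations_of_eqOn ?_ fun u hu => ?_
    · rw [b1WRep_domain, hrdd]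
    · rw [hrdi]
      rw [hrdd] at hu
      exact hbdry u hu
  have : KZ.of (cellRep split4Poly q) - KZ.of (b1WRep q) =
      (KZ.of rb - KZ.of rd) - (KZ.of rb - KZ.of rb') - (KZ.of rb' - KZ.of (cellRep split4Poly q)) +
        (KZ.of rd - KZ.of (b1WRep q)) := by abel
  rw [this]
  exact add_mem (sub_mem (sub_mem hrel hrel') hpin1) hpin2

end Summit.KontsevichZagierPeriods.RootDecompWalshStrata.Split4

end
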